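/-
Copyright (c) 2026 the pub-hodgecm-mathlib formalisation cell (harness21).  Prover seat hodgecm-mathlib-K2E1-p09 (g5), Track B ∕ K2-LIT, h413 =
`stmt-HodgeConjecture-24833`, line `K2_E1_TraceFormulaBeta`, campaign «EIS-RANK-ONE» rung R6g, deal (R6g-c)_two of the dealer K2E1-plan (g4) 2026-09-04T06:36:29Z: `z ↦ Λ^T E(φ, z)(g)` is
CONTINUOUS on `{Re z > 1}` at every `g ∈ U(J₂)(𝔸_{L⁺})` — the `N = 2` twin of ★ p857975 `K2E1TruncatedEisensteinContinuousCMThree` (§§1–2 there are N-generic and IMPORTED).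
-/
import Summits.HodgeConjecture.HodgeConjecture.Theorems.K2E1TruncatedEisensteinContinuousCMThree   -- ★ p857975 (K2E4-p10 g4): §§1–2 N-generic (dominated convergence, cocompactness bound, finite δ-set)
import Summits.HodgeConjecture.HodgeConjecture.Theorems.K2E1TruncatedEisensteinBoundedCMTwo        -- ★ p857723: N = 2 CM binders; imports ★ R6b Explicit (`siegel_two`), ★ R4a (`…_uncurry_cm_two`)
import Literature.NumberTheory.Automorphic.UnitaryGroupLineUnipotentTwo                          -- ★ Tate's line domain `n(𝓕⁻)`: `existsUnique_smul_mem_…_two`, `exists_isCompact_…_subset_two`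
import HarnessLib

/-!
# K2·E1 — `K2E1TruncatedEisensteinContinuousCMTwo`: `z ↦ Λ^T E(φ, z)(g)` IS CONTINUOUS ON `{Re z > 1}` AT EVERY `g ∈ U(J₂)(𝔸_{L⁺})`
# (campaign «EIS-RANK-ONE», rung R6g, brick (R6g-c)_two: the pointwise-continuity input `hcont` of the dominated-convergence step ★ (R6g-b)_two `K2E1MaassSelbergDiagonalCMTwo`, DISCHARGED)

Track B ∕ K2-LIT, crux h413 = `stmt-HodgeConjecture-24833`, route of record `HCCMUnconditional`; cell `hodgecm-mathlib`, squad K2, ENGINE E1.  Prover seat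
`hodgecm-mathlib-K2E1-p09` (g5); deal (R6g-c)_two of the dealer K2E1-plan (g4) 2026-09-04T06:36:29Z («twin of p857975; §§1–2 of p10's file are N-generic — IMPORT, do not restate»).
THEOREMS ONLY (no `def`, no `instance`, no notation, no named-fact hypothesis, no `sorry`); lane `--supports stmt-HodgeConjecture-24833 --as helper` (count-neutral).  Closes no socket.

THE MATHEMATICS [Arthur1980TraceFormulaII, §1 and §4; MoeglinWaldspurger1995, I.2.13, II.1.5, IV.2.3; Garrett2018, §2.10] — verbatim ★ p857975 §3 with `3 ↦ 2`, `2 < Re ↦ 1 < Re`.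
`Λ^T ψ(g) = ψ(g) − Σ_δ (𝟙_{H>T}·ψ_B)(δ g)` with AT MOST ONE high coset in `F`-rank one (★ p857975 §2 `continuousWithinAt_truncation_apply`, `hSiegel` = ★ `siegel_two`), so continuity of
`z ↦ Λ^T E(φ,z)(g)` reduces to that of `z ↦ E(φ,z)(g)` (★ R4a `continuous_eisensteinSeriesU_flatSectionU_uncurry_cm_two`) and of the constant terms `z ↦ E(φ,z)_B(x)` (★ p857975 §1
`continuousWithinAt_borelConstantTerm_of_bound`, dominated convergence over the finite measure `ν|_𝓕`, with the uniform bound from COCOMPACTNESS of `N(L⁺)` in `N(𝔸)` ★ p857975 §1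
`exists_forall_norm_unipotent_mul_le`).  The one `N = 2` ingredient: the compact set meeting every `N(F)`-orbit is Tate's LINE domain `n(𝓕⁻)` (★ `UnitaryGroupLineUnipotentTwo`:
`existsUnique_smul_mem_image_traceZeroFundamentalDomain_two`, `exists_isCompact_image_traceZeroFundamentalDomain_subset_two`) instead of the Heisenberg domain —
`exists_isCompact_rationalUnipotent_smul_mem_two`.  Heads: `continuous_borelConstantTerm_eisensteinSeriesU_flatSectionU_cm_two`, `continuous_truncation_eisensteinSeriesU_flatSectionU_apply_cm_two`,
**`continuousOn_truncation_eisensteinSeriesU_flatSectionU_apply_cm_two`** (`z ↦ Λ^T E(φ,z)(g)` continuous on `{Re z > 1}`, every `g`, any Haar `ν`, any `𝓕` with `ν(𝓕) < ∞`, `T ≥ 1`) and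
the sub-tube corollary **`continuousWithinAt_truncation_eisensteinSeriesU_flatSectionU_subtube_cm_two`** in the exact shape of ★ (R6g-b)_two's `hcont`.  No named input.
SAT-WITNESS: structural binders = Haar `ν` + a set `𝓕` with `ν 𝓕 ≠ ∞` (e.g. `∅`); no subgroup quantified.
HONEST LABEL: HC_CM is proved only modulo the 7 printed citations (2 remaining named inputs: hLiu418 = `stmt-HodgeConjecture-24832`, h413 = `stmt-HodgeConjecture-24833`) until rung 0
closes; this file asserts no named fact and closes no socket.
References: [Arthur1980TraceFormulaII] §1, §4 · [MoeglinWaldspurger1995] I.2.13, II.1.5, IV.2.3 · [Garrett2018] §2.10 · [Rogawski1990] §1.10, §2.1.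
-/

set_option autoImplicit false
-- the mandated namespace repeats the single-problem summit's segment (`HodgeConjecture.HodgeConjecture`)
set_option linter.dupNamespace false

noncomputable section

open MeasureTheory Measure NumberField IsDedekindDomain Set Filter Topology MulAction
open scoped ENNReal NNReal Pointwise
open Literature.NumberTheory.Automorphic Literature.NumberTheory.Automorphic.UnitaryGroup AdelicGroupData
open Summit.HodgeConjecture.HodgeConjecture.Cruxes.H413.K2E1BorelEisensteinU
open Summit.HodgeConjecture.HodgeConjecture.Cruxes.H413.K2E1TruncatedEisensteinExplicit
open Summit.HodgeConjecture.HodgeConjecture.Cruxes.H413.K2E1BorelEisensteinRegularU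
open Summit.HodgeConjecture.HodgeConjecture.Cruxes.H413.K2E1TruncatedEisensteinBoundedCMThree
open Summit.HodgeConjecture.HodgeConjecture.Cruxes.H413.K2E1TruncatedEisensteinBoundedCMTwo
open Summit.HodgeConjecture.HodgeConjecture.Cruxes.H413.K2E1TruncatedEisensteinContinuousCMThree

namespace Summit.HodgeConjecture.HodgeConjecture.Cruxes.H413.K2E1TruncatedEisensteinContinuousCMTwo

/-! ## §1 `U(J₂)`: Tate's line domain gives the compact cover of `N(F)∖N(𝔸)` -/

/-- **`U(J₂)`: Tate's LINE fundamental domain gives the compact cover** — there is a compact `C ⊆ N(𝔸_F)` meeting every left `N(F)`-orbit (★ `n(𝓕⁻)` ⊆ compact ★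
`exists_isCompact_image_traceZeroFundamentalDomain_subset_two`, and ★ `existsUnique_smul_mem_image_traceZeroFundamentalDomain_two`); the `N = 2` twin of ★
`exists_isCompact_rationalUnipotent_smul_mem_three`. [cite: Rogawski1990, §1.10] [cite: CasselsFrohlichANT1967, Ch. XV Thm. 4.1.3] -/
theorem exists_isCompact_rationalUnipotent_smul_mem_two {F E : Type} [Field F] [NumberField F] [Field E] [NumberField E] [Algebra F E] {c : E ≃ₐ[F] E} (hc : c * c = 1) :
    ∃ C : Set (adelicUnipotent F E c 2), IsCompact C ∧ ∀ u : adelicUnipotent F E c 2, ∃ γ : rationalUnipotent F E c 2, γ • u ∈ C := by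
  have hij : (((0 : Fin 2) : ℕ)) + 1 = ((1 : Fin 2) : ℕ) := by decide
  have hN : 2 = 2 * ((0 : Fin 2) : ℕ) + 2 := by decide
  obtain ⟨C, hC, hsub⟩ := exists_isCompact_image_traceZeroFundamentalDomain_subset_two (F := F) (E := E) (c := c) hij hN hc
  exact ⟨C, hC, fun u => (existsUnique_smul_mem_image_traceZeroFundamentalDomain_two hij hN hc u).exists.imp fun γ hγ => hsub hγ⟩

/-! ## §2 The CM pair `(L⁺, L, conj)`, `U(J₂)`: `z ↦ Λ^T E(φ, z)(g)` is continuous on `{Re z > 1}` -/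

section CM

variable (L : Type) [Field L] [NumberField L] [IsCMField L]
variable [MeasurableSpace (adelicUnipotent (↥(maximalRealSubfield L)) L (IsCMField.complexConj L) 2)] [BorelSpace (adelicUnipotent (↥(maximalRealSubfield L)) L (IsCMField.complexConj L) 2)]

/-- **`z ↦ E(φ, z)_B(x)` IS CONTINUOUS ON `{Re z > 1}`** (typed on the half-plane subtype) at every `x`, for `φ` continuous, bounded, left-`B(L⁺)`-invariant, any Haar `ν` and any `𝓕` with
`ν(𝓕) < ∞`: ★ p857975 §1 dominated convergence, the uniform bound by cocompactness (★ p857975 §1, §1 here) on a compact neighbourhood of the parameter, joint continuity ★ R4a `_cm_two`.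
[cite: MoeglinWaldspurger1995, II.1.5 and II.1.7] -/
theorem continuous_borelConstantTerm_eisensteinSeriesU_flatSectionU_cm_two
    (ν : Measure (adelicUnipotent (↥(maximalRealSubfield L)) L (IsCMField.complexConj L) 2)) [ν.IsHaarMeasure]
    {𝓕 : Set (adelicUnipotent (↥(maximalRealSubfield L)) L (IsCMField.complexConj L) 2)} (h𝓕top : ν 𝓕 ≠ ∞)
    {φ : (quasiSplit (↥(maximalRealSubfield L)) L (IsCMField.complexConj L) 2).Adelic → ℂ} (hφc : Continuous φ) {M : ℝ} (hφM : ∀ x, ‖φ x‖ ≤ M)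
    (hφB : ∀ b ∈ borelU ((IsCMField.complexConj L : L ≃ₐ[↥(maximalRealSubfield L)] L) : L →+* L) ((StdForm.antidiagonal 2).over L), ∀ x : (quasiSplit (↥(maximalRealSubfield L)) L (IsCMField.complexConj L) 2).Adelic, φ ((quasiSplit (↥(maximalRealSubfield L)) L (IsCMField.complexConj L) 2).toAdelic b * x) = φ x)
    (x : (quasiSplit (↥(maximalRealSubfield L)) L (IsCMField.complexConj L) 2).Adelic) :
    Continuous fun w : {z : ℂ // (1 : ℝ) < z.re} => borelConstantTerm ν 𝓕 (eisensteinSeriesU (flatSectionU φ (w : ℂ))) x := by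
  have hjoint := continuous_eisensteinSeriesU_flatSectionU_uncurry_cm_two L hφc hφM
  obtain ⟨C, hC, hcov⟩ := exists_isCompact_rationalUnipotent_smul_mem_two (F := ↥(maximalRealSubfield L)) (E := L) (c := IsCMField.complexConj L)
    (AlgEquiv.ext fun x => IsCMField.complexConj_apply_apply L x)
  refine continuous_iff_continuousAt.2 fun w₀ => ?_
  -- a compact neighbourhood `Z` of `w₀` in the half-plane
  set r : ℝ := ((w₀ : ℂ).re - 1) / 2 with hr
  have hr0 : 0 < r := by rw [hr]; linarith [w₀.2]
  have hball : ∀ z ∈ Metric.closedBall (w₀ : ℂ) r, (1 : ℝ) < z.re := by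
    intro z hz
    have hdist : dist z (w₀ : ℂ) ≤ r := Metric.mem_closedBall.1 hz
    have h1 := Complex.abs_re_le_norm (z - (w₀ : ℂ))
    rw [Complex.sub_re, ← Complex.dist_eq] at h1
    have h2 := (abs_le.1 (h1.trans hdist)).1
    rw [hr] at h2
    linarith [w₀.2]
  have hZ : IsCompact ((Subtype.val : {z : ℂ // (1 : ℝ) < z.re} → ℂ) ⁻¹' Metric.closedBall (w₀ : ℂ) r) := by
    have hsub : Metric.closedBall (w₀ : ℂ) r ∩ {z : ℂ | (1 : ℝ) < z.re} = Metric.closedBall (w₀ : ℂ) r := inter_eq_left.2 fun z hz => hball z hz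
    rw [Subtype.isCompact_iff, image_preimage_eq_inter_range, Subtype.range_coe_subtype, hsub]
    exact isCompact_closedBall _ _
  have hZn : ((Subtype.val : {z : ℂ // (1 : ℝ) < z.re} → ℂ) ⁻¹' Metric.closedBall (w₀ : ℂ) r) ∈ 𝓝 w₀ :=
    continuous_subtype_val.continuousAt.preimage_mem_nhds (Metric.closedBall_mem_nhds _ hr0)
  obtain ⟨C₀, hC₀⟩ := exists_forall_norm_unipotent_mul_le hC hcov hZ
    (Φ := fun (w : {z : ℂ // (1 : ℝ) < z.re}) y => eisensteinSeriesU (flatSectionU φ (w : ℂ)) y) hjoint.continuousOn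
    (fun w _ γ y => eisensteinSeriesU_flatSectionU_arithmeticSubgroup_mul hφB (w : ℂ) γ y) x
  -- dominated convergence over `ν|_𝓕`
  have hslice : ∀ u : (adelicUnipotent (↥(maximalRealSubfield L)) L (IsCMField.complexConj L) 2),
      Continuous fun w : {z : ℂ // (1 : ℝ) < z.re} => eisensteinSeriesU (flatSectionU φ (w : ℂ)) ((u : (quasiSplit (↥(maximalRealSubfield L)) L (IsCMField.complexConj L) 2).Adelic) * x) := by
    intro u
    have h1 : Continuous fun w : {z : ℂ // (1 : ℝ) < z.re} => ((w, ((u : (quasiSplit (↥(maximalRealSubfield L)) L (IsCMField.complexConj L) 2).Adelic) * x)) : {z : ℂ // (1 : ℝ) < z.re} × (quasiSplit (↥(maximalRealSubfield L)) L (IsCMField.complexConj L) 2).Adelic) :=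
      continuous_id.prodMk continuous_const
    have h2 := hjoint.comp h1
    rw [Function.comp_def] at h2
    exact h2
  have hmulx : Continuous fun u : (adelicUnipotent (↥(maximalRealSubfield L)) L (IsCMField.complexConj L) 2) => ((u : (quasiSplit (↥(maximalRealSubfield L)) L (IsCMField.complexConj L) 2).Adelic) * x) := continuous_subtype_val.mul continuous_const
  have hmeas : ∀ w : {z : ℂ // (1 : ℝ) < z.re}, AEStronglyMeasurable
      (fun u : (adelicUnipotent (↥(maximalRealSubfield L)) L (IsCMField.complexConj L) 2) => eisensteinSeriesU (flatSectionU φ (w : ℂ)) ((u : (quasiSplit (↥(maximalRealSubfield L)) L (IsCMField.complexConj L) 2).Adelic) * x)) (ν.restrict 𝓕) := by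
    intro w
    have h3 := (continuous_eisensteinSeriesU_flatSectionU_cm_two L w.2 hφc hφM).comp hmulx
    rw [Function.comp_def] at h3
    exact h3.aestronglyMeasurable
  exact (continuousWithinAt_univ _ _).1
    (continuousWithinAt_borelConstantTerm_of_bound (S := (univ : Set {z : ℂ // (1 : ℝ) < z.re})) ν h𝓕top x (Eventually.of_forall hmeas) (C := C₀)
      (mem_nhdsWithin_of_mem_nhds (Filter.mem_of_superset hZn fun w hw => hC₀ w hw)) fun u => (hslice u).continuousAt.continuousWithinAt)

/-- **`z ↦ Λ^T E(φ, z)(g)` IS CONTINUOUS ON `{Re z > 1}`** (typed on the half-plane subtype) at every `g`: ★ p857975 §2 with `hSiegel` ★ `siegel_two`, the joint continuity ★ R4a for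
`z ↦ E(φ,z)(g)`, and the constant terms by `continuous_borelConstantTerm_eisensteinSeriesU_flatSectionU_cm_two`.  `φ` continuous, bounded, left-`B(L⁺)`-invariant; any Haar `ν`, any `𝓕`
with `ν(𝓕) < ∞`, `T ≥ 1`. [cite: Arthur1980TraceFormulaII, §4] [cite: MoeglinWaldspurger1995, IV.2.3] -/
theorem continuous_truncation_eisensteinSeriesU_flatSectionU_apply_cm_two
    (ν : Measure (adelicUnipotent (↥(maximalRealSubfield L)) L (IsCMField.complexConj L) 2)) [ν.IsHaarMeasure]
    {𝓕 : Set (adelicUnipotent (↥(maximalRealSubfield L)) L (IsCMField.complexConj L) 2)} (h𝓕top : ν 𝓕 ≠ ∞) {T : ℝ≥0} (hT : 1 ≤ T)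
    {φ : (quasiSplit (↥(maximalRealSubfield L)) L (IsCMField.complexConj L) 2).Adelic → ℂ} (hφc : Continuous φ) {M : ℝ} (hφM : ∀ x, ‖φ x‖ ≤ M)
    (hφB : ∀ b ∈ borelU ((IsCMField.complexConj L : L ≃ₐ[↥(maximalRealSubfield L)] L) : L →+* L) ((StdForm.antidiagonal 2).over L), ∀ x : (quasiSplit (↥(maximalRealSubfield L)) L (IsCMField.complexConj L) 2).Adelic, φ ((quasiSplit (↥(maximalRealSubfield L)) L (IsCMField.complexConj L) 2).toAdelic b * x) = φ x)
    (g : (quasiSplit (↥(maximalRealSubfield L)) L (IsCMField.complexConj L) 2).Adelic) :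
    Continuous fun w : {z : ℂ // (1 : ℝ) < z.re} => truncation ν 𝓕 T (eisensteinSeriesU (flatSectionU φ (w : ℂ))) g := by
  have hjoint := continuous_eisensteinSeriesU_flatSectionU_uncurry_cm_two L hφc hφM
  have hg : Continuous fun w : {z : ℂ // (1 : ℝ) < z.re} => eisensteinSeriesU (flatSectionU φ (w : ℂ)) g := by
    have h1 : Continuous fun w : {z : ℂ // (1 : ℝ) < z.re} => ((w, g) : {z : ℂ // (1 : ℝ) < z.re} × (quasiSplit (↥(maximalRealSubfield L)) L (IsCMField.complexConj L) 2).Adelic) :=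
      continuous_id.prodMk continuous_const
    have h2 := hjoint.comp h1
    rw [Function.comp_def] at h2
    exact h2
  refine continuous_iff_continuousAt.2 fun w₀ => (continuousWithinAt_univ _ _).1 ?_
  exact continuousWithinAt_truncation_apply (Φ := fun (w : {z : ℂ // (1 : ℝ) < z.re}) y => eisensteinSeriesU (flatSectionU φ (w : ℂ)) y) siegel_two ν 𝓕 hT g
    hg.continuousAt.continuousWithinAt fun x _ => (continuous_borelConstantTerm_eisensteinSeriesU_flatSectionU_cm_two L ν h𝓕top hφc hφM hφB x).continuousAt.continuousWithinAt

/-- **`z ↦ Λ^T E(φ, z)(g)` IS CONTINUOUS ON THE OPEN HALF-PLANE `{z | Re z > 1}`** (plain `ContinuousOn` on `ℂ`), every `g`. [cite: Arthur1980TraceFormulaII, §4] [cite: MoeglinWaldspurger1995, IV.2.3] -/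
theorem continuousOn_truncation_eisensteinSeriesU_flatSectionU_apply_cm_two
    (ν : Measure (adelicUnipotent (↥(maximalRealSubfield L)) L (IsCMField.complexConj L) 2)) [ν.IsHaarMeasure]
    {𝓕 : Set (adelicUnipotent (↥(maximalRealSubfield L)) L (IsCMField.complexConj L) 2)} (h𝓕top : ν 𝓕 ≠ ∞) {T : ℝ≥0} (hT : 1 ≤ T)
    {φ : (quasiSplit (↥(maximalRealSubfield L)) L (IsCMField.complexConj L) 2).Adelic → ℂ} (hφc : Continuous φ) {M : ℝ} (hφM : ∀ x, ‖φ x‖ ≤ M)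
    (hφB : ∀ b ∈ borelU ((IsCMField.complexConj L : L ≃ₐ[↥(maximalRealSubfield L)] L) : L →+* L) ((StdForm.antidiagonal 2).over L), ∀ x : (quasiSplit (↥(maximalRealSubfield L)) L (IsCMField.complexConj L) 2).Adelic, φ ((quasiSplit (↥(maximalRealSubfield L)) L (IsCMField.complexConj L) 2).toAdelic b * x) = φ x)
    (g : (quasiSplit (↥(maximalRealSubfield L)) L (IsCMField.complexConj L) 2).Adelic) :
    ContinuousOn (fun z : ℂ => truncation ν 𝓕 T (eisensteinSeriesU (flatSectionU φ z)) g) {z : ℂ | (1 : ℝ) < z.re} :=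
  continuousOn_iff_continuous_restrict.2 (continuous_truncation_eisensteinSeriesU_flatSectionU_apply_cm_two L ν h𝓕top hT hφc hφM hφB g)

/-- **The `hcont` input of ★ (R6g-b)_two `maassSelberg_diagonal_flatSectionU_cm_two`, DISCHARGED**: for `Re z > 1`, `z′ ↦ Λ^T E(φ, z′)(g)` is continuous within the sub-tube
`{1 < Re z′ < Re z}` at `z′ = z`, every `g`. [cite: Arthur1980TraceFormulaII, §4] [cite: MoeglinWaldspurger1995, IV.2.3] -/
theorem continuousWithinAt_truncation_eisensteinSeriesU_flatSectionU_subtube_cm_two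
    (ν : Measure (adelicUnipotent (↥(maximalRealSubfield L)) L (IsCMField.complexConj L) 2)) [ν.IsHaarMeasure]
    {𝓕 : Set (adelicUnipotent (↥(maximalRealSubfield L)) L (IsCMField.complexConj L) 2)} (h𝓕top : ν 𝓕 ≠ ∞) {T : ℝ≥0} (hT : 1 ≤ T)
    {φ : (quasiSplit (↥(maximalRealSubfield L)) L (IsCMField.complexConj L) 2).Adelic → ℂ} (hφc : Continuous φ) {M : ℝ} (hφM : ∀ x, ‖φ x‖ ≤ M)
    (hφB : ∀ b ∈ borelU ((IsCMField.complexConj L : L ≃ₐ[↥(maximalRealSubfield L)] L) : L →+* L) ((StdForm.antidiagonal 2).over L), ∀ x : (quasiSplit (↥(maximalRealSubfield L)) L (IsCMField.complexConj L) 2).Adelic, φ ((quasiSplit (↥(maximalRealSubfield L)) L (IsCMField.complexConj L) 2).toAdelic b * x) = φ x)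
    {z : ℂ} (hz : 1 < z.re) (g : (quasiSplit (↥(maximalRealSubfield L)) L (IsCMField.complexConj L) 2).Adelic) :
    ContinuousWithinAt (fun z' : ℂ => truncation ν 𝓕 T (eisensteinSeriesU (flatSectionU φ z')) g) {z' : ℂ | 1 < z'.re ∧ z'.re < z.re} z :=
  ((continuousOn_truncation_eisensteinSeriesU_flatSectionU_apply_cm_two L ν h𝓕top hT hφc hφM hφB g).continuousAt
    ((isOpen_lt continuous_const Complex.continuous_re).mem_nhds hz)).continuousWithinAt

end CM

end Summit.HodgeConjecture.HodgeConjecture.Cruxes.H413.K2E1TruncatedEisensteinContinuousCMTwo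

end
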